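import Literature.Computability.ImplicitComplexity.SoftTypeAssignmentRounds
import HarnessLib

/-!
# One pass of a finite-state transducer over a Church list, as a `Λ` program

The deterministic transition terms `Trᵢ : TM ⊸ TM` of GMR08 (= Gaboardi–Marion–Ronchi Della
Rocca 2008, Thm. 5.14, §3.2) rewritten for the tree's tableau form of a `FinTM2` step: one
transition is ONE FOLD of a Mealy machine (finite control, one output symbol per input symbol)
over the Church list of tableau blocks. This file gives the untyped programs and their
`β`-specifications:

* finite data `oneHot q i` and case analysis `caseT1` / `caseT2` (decision trees whose branches are
  closed, so that the scrutinised linear resources are passed AFTER the selection);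
* the step `STEPc T = λc u p. p (λq acc. T q u c acc)` with leaves `LEAF q' e = λk a. ⟨q', k e a⟩`
  and states `Stq q acc = PAIR q acc`, and the pass `passC (STEPc T) (PAIR q₀) 1`;
* `RowLike R vs` — the behavioural notion of "`R` is a Church list of `vs`": `R K Z →β* K v₀ (⋯ Z)`
  for all closed `K Z`; Church lists are row-like, and **a pass maps a row-like term to a row-like
  term for the transducer's output** (`PassC.rowLike_app`), by the Mealy semantics `mealy`
  (= Mathlib's `List.mapAccumr`);
* the final projection `OUTc so s₀ bs = λr. r so s₀ b₀ ⋯` of a finite-state fold (`outc_spec`).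

## References

* [GaboardiMarionRonchidellarocca2008] §3.2 (booleans, strings, `⟨M,N⟩`, iteration), Thm. 5.14.
-/

namespace Literature.Computability.ImplicitComplexity

namespace STA

open Term

/-! ### Iterated lifting of a substitution -/

/-- `⇑ⁿτ` below `n` is the identity. [folklore] -/
theorem iterate_up_lt (τ : ℕ → Term) {n i : ℕ} (h : i < n) : (Term.up^[n] τ) i = .var i := by
  induction n generalizing i with
  | zero => exact absurd h (Nat.not_lt_zero i)
  | succ n ih =>
    rw [Function.iterate_succ_apply']
    cases i with
    | zero => rfl
    | succ i =>
      simp only [Term.up]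
      rw [ih (by omega)]
      rfl

/-- `⇑ⁿτ` at `n + i` is `τ i` shifted by `n`. [folklore] -/
theorem iterate_up_add (τ : ℕ → Term) (n i : ℕ) : (Term.up^[n] τ) (n + i) = (τ i).rename (· + n) := by
  induction n generalizing i with
  | zero => simp [rename_id' ]
  | succ n ih =>
    rw [Function.iterate_succ_apply', show n + 1 + i = (n + i) + 1 by omega]
    simp only [Term.up, ih, rename_rename]
    rfl

/-- `⇑ⁿτ` at an index `≥ n` holding a closed term. [folklore] -/
theorem iterate_up_closed (τ : ℕ → Term) {n i : ℕ} (h : n ≤ i) (hc : (τ (i - n)).Closed) :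
    (Term.up^[n] τ) i = τ (i - n) := by
  obtain ⟨j, rfl⟩ : ∃ j, i = n + j := ⟨i - n, by omega⟩
  rw [Nat.add_sub_cancel_left] at hc
  rw [iterate_up_add, Nat.add_sub_cancel_left, hc.rename_eq]

/-! ### Case analysis on finite data -/

/-- `caseT1 [l₀,…,l_{k-1}] = λv. v l₀ ⋯ l_{k-1}`. [cite: GaboardiMarionRonchidellarocca2008, §3.2 (if-then-else)] -/
def caseT1 (ls : List Term) : Term := .lam ((Term.var 0).apps ls)

/-- `caseT1` of closed branches is closed. [folklore] -/
theorem closed_caseT1 {ls : List Term} (h : ∀ l ∈ ls, l.Closed) : (caseT1 ls).Closed := by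
  rw [caseT1, closed_lam]
  exact bnd_apps (by decide) fun l hl => (h l hl).bnd 1

/-- **`caseT1 l⃗ (oneHot k i) a⃗ →β* lᵢ a⃗`.** [cite: GaboardiMarionRonchidellarocca2008, §3.2] -/
theorem caseT1_spec {ls : List Term} (h : ∀ l ∈ ls, l.Closed) {i : ℕ} (hi : i < ls.length) (as : List Term) :
    BetaReduces ((caseT1 ls).apps (oneHot ls.length i :: as)) ((ls.getD i (.var 0)).apps as) := by
  have h1 := hbStar_apps_lams ((Term.var 0).apps ls) 1 [oneHot ls.length i] rfl (by simp [closed_oneHot hi]) as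
  simp only [substp_apps, Term.substp, instN, List.getD] at h1
  rw [show (ls.map fun N => N.substp (instN 1 [oneHot ls.length i])) = ls from
    List.map_congr_left (fun l hl => (h l hl).substp_eq _) |>.trans (List.map_id' ls)] at h1
  simp only [Nat.lt_one_iff, ite_true] at h1
  refine h1.betaReduces.trans' ?_
  rw [← apps_append]
  exact apps_oneHot_betaReduces_append hi rfl h as

/-- `caseT2 rows = λa b. a (caseT1 row₀) ⋯ (caseT1 row_{k-1}) b`. [cite: GaboardiMarionRonchidellarocca2008, §3.2] -/
def caseT2 (rows : List (List Term)) : Term := lams 2 ((Term.var 1).apps (rows.map caseT1 ++ [.var 0]))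

/-- `caseT2` of closed leaves is closed. [folklore] -/
theorem closed_caseT2 {rows : List (List Term)} (h : ∀ r ∈ rows, ∀ l ∈ r, l.Closed) : (caseT2 rows).Closed := by
  simp only [caseT2, Closed, bnd_lams, Nat.zero_add]
  refine bnd_apps (by decide) fun l hl => ?_
  rcases List.mem_append.1 hl with hl | hl
  · obtain ⟨r, hr, rfl⟩ := List.mem_map.1 hl
    exact (closed_caseT1 (h r hr)).bnd 2
  · rw [List.mem_singleton] at hl; subst hl; decide

/-- **`caseT2 rows (oneHot k i) (oneHot k' j) a⃗ →β* rows[i][j] a⃗`** (all rows of length `k'`).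
[cite: GaboardiMarionRonchidellarocca2008, §3.2] -/
theorem caseT2_spec {rows : List (List Term)} (h : ∀ r ∈ rows, ∀ l ∈ r, l.Closed) {k' : ℕ}
    (hlen : ∀ r ∈ rows, r.length = k') {i j : ℕ} (hi : i < rows.length) (hj : j < k') (as : List Term) :
    BetaReduces ((caseT2 rows).apps (oneHot rows.length i :: oneHot k' j :: as))
      (((rows.getD i []).getD j (.var 0)).apps as) := by
  have hcl : ∀ l ∈ rows.map caseT1, l.Closed := fun l hl => by
    obtain ⟨r, hr, rfl⟩ := List.mem_map.1 hl; exact closed_caseT1 (h r hr)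
  have h1 := hbStar_apps_lams ((Term.var 1).apps (rows.map caseT1 ++ [.var 0])) 2 [oneHot rows.length i, oneHot k' j] rfl
    (by simp [closed_oneHot hi, closed_oneHot hj]) as
  simp only [substp_apps, Term.substp, instN, List.getD, List.map_append, List.map_cons, List.map_nil] at h1
  rw [show ((rows.map caseT1).map fun N => N.substp (instN 2 [oneHot rows.length i, oneHot k' j])) = rows.map caseT1 from
    List.map_congr_left (fun l hl => (hcl l hl).substp_eq _) |>.trans (List.map_id' _)] at h1
  simp only [show (1 : ℕ) < 2 from by omega, show (0 : ℕ) < 2 from by omega, ite_true] at h1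
  norm_num at h1
  refine h1.betaReduces.trans' ?_
  rw [show ((oneHot rows.length i).apps (rows.map caseT1 ++ [oneHot k' j])).apps as =
      (oneHot rows.length i).apps (rows.map caseT1 ++ (oneHot k' j :: as)) by simp only [apps_append]; rfl]
  refine (apps_oneHot_betaReduces_append hi (ts := rows.map caseT1) (by simp) hcl (oneHot k' j :: as)).trans' ?_
  have hri : rows.getD i [] ∈ rows := by
    rw [List.getD_eq_getElem?_getD, List.getElem?_eq_getElem hi, Option.getD_some]; exact List.getElem_mem hi
  have e1 : (rows.map caseT1).getD i (.var 0) = caseT1 (rows.getD i []) := by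
    simp [List.getD_eq_getElem?_getD, List.getElem?_eq_getElem hi]
  rw [e1]
  have := caseT1_spec (h _ hri) (i := j) (by rw [hlen _ hri]; exact hj) as
  rwa [hlen _ hri] at this

/-! ### States, leaves and the step of a pass -/

/-- The state `Stq q acc = PAIR q acc` of a pass (finite control, output built so far). [cite: GaboardiMarionRonchidellarocca2008, §3.2] -/
def Stq (q acc : Term) : Term := PAIR.apps [q, acc]

/-- States of closed parts are closed. [folklore] -/
theorem closed_Stq {q acc : Term} (hq : q.Closed) (ha : acc.Closed) : (Stq q acc).Closed := by
  simp [Stq, closed_PAIR, hq, ha]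

/-- The leaf `LEAF q' e = λk a. ⟨q', k e a⟩`: new control `q'`, emit `e`. [cite: GaboardiMarionRonchidellarocca2008, Thm. 5.14 (proof)] -/
def LEAF (q' e : Term) : Term := lams 2 (Stq q' ((Term.var 1).apps [e, .var 0]))

/-- Leaves of closed parts are closed. [folklore] -/
theorem closed_LEAF {q' e : Term} (hq : q'.Closed) (he : e.Closed) : (LEAF q' e).Closed := by
  simp only [LEAF, Stq, Closed, bnd_lams, Nat.zero_add]
  refine bnd_apps (closed_PAIR.bnd 2) ?_
  intro N hN
  simp only [List.mem_cons, List.not_mem_nil, or_false] at hN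
  rcases hN with rfl | rfl
  · exact hq.bnd 2
  · exact bnd_apps (by decide) (by simp [he.bnd 2])

/-- **`LEAF q' e K A →β* ⟨q', K e A⟩`.** [folklore] -/
theorem LEAF_spec {q' e K A : Term} (hq : q'.Closed) (he : e.Closed) (hK : K.Closed) (hA : A.Closed) :
    BetaReduces ((LEAF q' e).apps [K, A]) (Stq q' (K.apps [e, A])) := by
  have h1 := apps_lams_betaReduces (Stq q' ((Term.var 1).apps [e, .var 0])) 2 [K, A] rfl (by simp [hK, hA])
  have e1 : (Stq q' ((Term.var 1).apps [e, .var 0])).substp (instN 2 [K, A]) = Stq q' (K.apps [e, A]) := by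
    simp [Stq, Term.substp, instN, List.getD, closed_PAIR.substp_eq, hq.substp_eq, he.substp_eq]
  rwa [e1] at h1

/-- The step `STEPc T = λc u p. p (λq acc. T q u c acc)` of a pass with transition tree `T`.
[cite: GaboardiMarionRonchidellarocca2008, Thm. 5.14 (proof)] -/
def STEPc (T : Term) : Term := lams 3 ((Term.var 0).app (lams 2 (T.apps [.var 1, .var 3, .var 4, .var 0])))

/-- The step is closed. [folklore] -/
theorem closed_STEPc {T : Term} (hT : T.Closed) : (STEPc T).Closed := by
  simp only [STEPc, Closed, bnd_lams, bnd_app, bnd_var, Nat.zero_add, Bool.and_eq_true, decide_eq_true_eq]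
  exact ⟨by omega, bnd_apps (hT.bnd 5) (by simp)⟩

/-- A transition tree `T` realises the Mealy transition `δ` on `nQ` states, `nU` inputs, `nE` outputs.
[folklore] -/
def TSpec (T : Term) (nQ nU nE : ℕ) (δ : Fin nQ → Fin nU → Fin nQ × Fin nE) : Prop :=
  T.Closed ∧ ∀ (q : Fin nQ) (u : Fin nU),
    BetaReduces (T.apps [oneHot nQ q, oneHot nU u]) (LEAF (oneHot nQ (δ q u).1) (oneHot nE (δ q u).2))

/-- **One step of a pass**: `STEPc T K u ⟨q, A⟩ →β* ⟨q', K e A⟩` where `(q', e) = δ q u`.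
[cite: GaboardiMarionRonchidellarocca2008, Thm. 5.14 (proof)] -/
theorem STEPc_spec {T : Term} {nQ nU nE : ℕ} {δ : Fin nQ → Fin nU → Fin nQ × Fin nE} (hT : TSpec T nQ nU nE δ)
    {K A : Term} (hK : K.Closed) (hA : A.Closed) (q : Fin nQ) (u : Fin nU) :
    BetaReduces ((STEPc T).apps [K, oneHot nU u, Stq (oneHot nQ q) A])
      (Stq (oneHot nQ (δ q u).1) (K.apps [oneHot nE (δ q u).2, A])) := by
  have hu : (oneHot nU (u : ℕ)).Closed := closed_oneHot u.2
  have hq : (oneHot nQ (q : ℕ)).Closed := closed_oneHot q.2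
  have hSt : (Stq (oneHot nQ q) A).Closed := closed_Stq hq hA
  -- the continuation `λq acc. T q u K acc` after instantiating `c u p`
  set CONT : Term := lams 2 (T.apps [.var 1, oneHot nU u, K, .var 0]) with hCONT
  have hCONTc : CONT.Closed := by
    simp only [hCONT, Closed, bnd_lams, Nat.zero_add]
    exact bnd_apps (hT.1.bnd 2) (by simp [hu.bnd 2, hK.bnd 2])
  -- three head steps
  have h1 := apps_lams_betaReduces ((Term.var 0).app (lams 2 (T.apps [.var 1, .var 3, .var 4, .var 0]))) 3
    [K, oneHot nU u, Stq (oneHot nQ q) A] rfl (by simp [hK, hu, hSt])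
  have e1 : ((Term.var 0).app (lams 2 (T.apps [.var 1, .var 3, .var 4, .var 0]))).substp
      (instN 3 [K, oneHot nU u, Stq (oneHot nQ q) A]) = (Stq (oneHot nQ q) A).app CONT := by
    simp [hCONT, Term.up, Term.substp, Term.rename, instN, List.getD, hT.1.substp_eq, hu.rename_eq, hK.rename_eq]
  rw [e1] at h1
  refine h1.trans' ?_
  -- unpair: ⟨q, A⟩ CONT →β* CONT q A
  refine (apps_PAIR_betaReduces hq hA hCONTc []).trans' ?_
  -- the continuation receives q and A
  have h2 := apps_lams_betaReduces (T.apps [.var 1, oneHot nU u, K, .var 0]) 2 [oneHot nQ q, A] rfl (by simp [hq, hA])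
  have e2 : (T.apps [.var 1, oneHot nU u, K, .var 0]).substp (instN 2 [oneHot nQ q, A]) = T.apps [oneHot nQ q, oneHot nU u, K, A] := by
    simp [Term.substp, instN, List.getD, hT.1.substp_eq, hu.substp_eq, hK.substp_eq]
  rw [e2] at h2
  refine h2.trans' ?_
  -- the tree, then the leaf
  have h3 := (hT.2 q u).apps_head [K, A]
  exact h3.trans' (LEAF_spec (closed_oneHot (δ q u).1.2) (closed_oneHot (δ q u).2.2) hK hA)

/-! ### Row-like terms and the semantics of a pass -/

/-- `RowLike R vs`: the closed term `R` folds like the Church list of `vs`. [folklore] -/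
def RowLike (R : Term) (vs : List Term) : Prop :=
  R.Closed ∧ ∀ K Z : Term, K.Closed → Z.Closed → BetaReduces (R.apps [K, Z]) (chain K Z vs)

/-- Church lists are row-like. [cite: GaboardiMarionRonchidellarocca2008, §3.2] -/
theorem rowLike_encList {vs : List Term} (hvs : ∀ v ∈ vs, v.Closed) : RowLike (encList vs) vs :=
  ⟨closed_encList hvs, fun K Z hK hZ => by simpa using apps_encList_betaReduces hvs hK hZ []⟩

/-- A term `β`-reducing to a row-like term is row-like. [folklore] -/
theorem RowLike.of_betaReduces {R R' : Term} {vs : List Term} (h : RowLike R' vs) (hR : R.Closed) (hred : BetaReduces R R') :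
    RowLike R vs :=
  ⟨hR, fun K Z hK hZ => (hred.apps_head [K, Z]).trans' (h.2 K Z hK hZ)⟩

/-- The Mealy semantics of a pass: fold from the END of the list, threading the control and
emitting one symbol per input.  This is Mathlib's `List.mapAccumr` with the arguments in automaton
order (transition `δ : state → input → state × output`, initial state, inputs); in particular the
output has the length of the input by `List.length_mapAccumr`. [folklore] -/
abbrev mealy {σ α β : Type} (δ : σ → α → σ × β) (q₀ : σ) (as : List α) : σ × List β :=
  List.mapAccumr (fun a q => δ q a) as q₀

/-- `mealy` on the empty input. [folklore] -/
@[simp] theorem mealy_nil {σ α β : Type} (δ : σ → α → σ × β) (q₀ : σ) : mealy δ q₀ [] = (q₀, []) := rfl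

/-- `mealy` reads the head LAST: one more transition from the state reached on the tail. [folklore] -/
@[simp] theorem mealy_cons {σ α β : Type} (δ : σ → α → σ × β) (q₀ : σ) (a : α) (as : List α) :
    mealy δ q₀ (a :: as) = ((δ (mealy δ q₀ as).1 a).1, (δ (mealy δ q₀ as).1 a).2 :: (mealy δ q₀ as).2) := rfl

/-- **The fold of a pass**: `STEPc T K u₀ (⋯ (STEPc T K u_{k-1} ⟨q₀, Z⟩)) →β* ⟨q, K e₀ (⋯ (K e_{k-1} Z))⟩`
with `(q, e⃗) = mealy δ q₀ u⃗`. [cite: GaboardiMarionRonchidellarocca2008, Thm. 5.14 (proof)] -/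
theorem chain_STEPc_spec {T : Term} {nQ nU nE : ℕ} {δ : Fin nQ → Fin nU → Fin nQ × Fin nE} (hT : TSpec T nQ nU nE δ)
    {K Z : Term} (hK : K.Closed) (hZ : Z.Closed) (q₀ : Fin nQ) (us : List (Fin nU)) :
    BetaReduces (chain ((STEPc T).app K) (Stq (oneHot nQ q₀) Z) (us.map fun u : Fin nU => oneHot nU u.val))
      (Stq (oneHot nQ (mealy δ q₀ us).1) (chain K Z ((mealy δ q₀ us).2.map fun e : Fin nE => oneHot nE e.val))) := by
  induction us with
  | nil => exact BetaReduces.rfl' _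
  | cons u us ih =>
    rw [List.map_cons, chain_cons]
    have hA : (chain K Z ((mealy δ q₀ us).2.map fun e : Fin nE => oneHot nE e.val)).Closed :=
      closed_chain hK hZ fun v hv => by obtain ⟨e, -, rfl⟩ := List.mem_map.1 hv; exact closed_oneHot e.2
    refine (BetaReduces.apps_args _ (List.Forall₂.cons (BetaReduces.rfl' _) (List.Forall₂.cons ih List.Forall₂.nil))).trans' ?_
    have := STEPc_spec hT hK hA (mealy δ q₀ us).1 u
    simpa [mealy_cons] using this

/-- The pass of a transition tree from the initial control `q₀`: `passC (STEPc T) (PAIR q₀) 1`.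
[cite: GaboardiMarionRonchidellarocca2008, Thm. 5.14 (proof)] -/
def PassC.ofTree (T : Term) (hT : T.Closed) {nQ : ℕ} (q₀ : Fin nQ) : PassC where
  S := STEPc T
  I := PAIR.app (oneHot nQ q₀)
  F := one
  hS := closed_STEPc hT
  hI := closed_app.2 ⟨closed_PAIR, closed_oneHot q₀.2⟩
  hF := closed_one

/-- **A pass maps row-like terms to row-like terms, computing the transducer's output.**
[cite: GaboardiMarionRonchidellarocca2008, Thm. 5.14 (proof)] -/
theorem PassC.rowLike_app {T : Term} {nQ nU nE : ℕ} {δ : Fin nQ → Fin nU → Fin nQ × Fin nE} (hT : TSpec T nQ nU nE δ)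
    (q₀ : Fin nQ) {R : Term} {us : List (Fin nU)} (hR : RowLike R (us.map fun u : Fin nU => oneHot nU u.val)) :
    RowLike ((PassC.ofTree T hT.1 q₀).term.app R) ((mealy δ q₀ us).2.map fun e : Fin nE => oneHot nE e.val) := by
  refine ⟨closed_app.2 ⟨(PassC.ofTree T hT.1 q₀).closed_term, hR.1⟩, fun K Z hK hZ => ?_⟩
  have h1 := ((PassC.ofTree T hT.1 q₀).round hR.1 hK hZ []).betaReduces
  refine h1.trans' ?_
  simp only [PassC.φ, PassC.ofTree]
  -- fold R with the step
  have hSK : ((STEPc T).app K).Closed := closed_app.2 ⟨closed_STEPc hT.1, hK⟩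
  have hIZ : ((PAIR.app (oneHot nQ q₀)).app Z).Closed := closed_app.2 ⟨closed_app.2 ⟨closed_PAIR, closed_oneHot q₀.2⟩, hZ⟩
  have h2 := (hR.2 _ _ hSK hIZ).apps_head [one]
  rw [show R.apps [(STEPc T).app K, (PAIR.app (oneHot nQ q₀)).app Z, one] =
    (R.apps [(STEPc T).app K, (PAIR.app (oneHot nQ q₀)).app Z]).apps [one] by rfl]
  refine h2.trans' ?_
  have h3 := (chain_STEPc_spec hT hK hZ q₀ us).apps_head [one]
  refine h3.trans' ?_
  -- finish: ⟨q, acc⟩ 1 →β* acc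
  have hacc : (chain K Z ((mealy δ q₀ us).2.map fun e : Fin nE => oneHot nE e.val)).Closed :=
    closed_chain hK hZ fun v hv => by obtain ⟨e, -, rfl⟩ := List.mem_map.1 hv; exact closed_oneHot e.2
  refine (apps_PAIR_betaReduces (closed_oneHot (mealy δ q₀ us).1.2) hacc closed_one []).trans' ?_
  rw [one_eq_oneHot]
  simpa using apps_oneHot_betaReduces (q := 2) (i := 1) (by omega) (ts := [oneHot nQ (mealy δ q₀ us).1, _]) rfl
    (by simp [closed_oneHot (mealy δ q₀ us).1.2, hacc])

/-! ### The final projection of a finite-state fold -/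

/-- The finite-state fold step `so T' = λu q. T' q u` of the acceptance test. [folklore] -/
def soC (T' : Term) : Term := lams 2 (T'.apps [.var 0, .var 1])

/-- `so` is closed. [folklore] -/
theorem closed_soC {T' : Term} (hT : T'.Closed) : (soC T').Closed := by
  simp only [soC, Closed, bnd_lams, Nat.zero_add]
  exact bnd_apps (hT.bnd 2) (by simp)

/-- A state-transition tree `T'` realises `δ' : Fin nQ → Fin nU → Fin nQ`. [folklore] -/
def TSpec' (T' : Term) (nQ nU : ℕ) (δ' : Fin nQ → Fin nU → Fin nQ) : Prop :=
  T'.Closed ∧ ∀ (q : Fin nQ) (u : Fin nU), BetaReduces (T'.apps [oneHot nQ q, oneHot nU u]) (oneHot nQ (δ' q u))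

/-- **The finite-state fold**: `so u₀ (⋯ (so u_{k-1} q₀)) →β* q` with `q = foldr`. [folklore] -/
theorem chain_soC_spec {T' : Term} {nQ nU : ℕ} {δ' : Fin nQ → Fin nU → Fin nQ} (hT : TSpec' T' nQ nU δ') (q₀ : Fin nQ)
    (us : List (Fin nU)) :
    BetaReduces (chain (soC T') (oneHot nQ q₀) (us.map fun u : Fin nU => oneHot nU u.val))
      (oneHot nQ (us.foldr (fun (u : Fin nU) (q : Fin nQ) => δ' q u) q₀).val) := by
  induction us with
  | nil => exact BetaReduces.rfl' _
  | cons u us ih =>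
    rw [List.map_cons, chain_cons, List.foldr_cons]
    refine (BetaReduces.apps_args _ (List.Forall₂.cons (BetaReduces.rfl' _) (List.Forall₂.cons ih List.Forall₂.nil))).trans' ?_
    have h1 := apps_lams_betaReduces (T'.apps [.var 0, .var 1]) 2 [oneHot nU u, oneHot nQ (us.foldr (fun (u : Fin nU) (q : Fin nQ) => δ' q u) q₀).val] rfl
      (by simp [closed_oneHot u.2, closed_oneHot (us.foldr (fun u q => δ' q u) q₀).2])
    simp only [substp_apps, Term.substp, instN, List.getD, List.map_cons, List.map_nil, hT.1.substp_eq] at h1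
    norm_num at h1
    exact h1.trans' (hT.2 _ u)

/-- The acceptance program `OUTc so s₀ bs = λr. r so s₀ b₀ ⋯ b_{K-1}`. [cite: GaboardiMarionRonchidellarocca2008, §3.2 (Ext)] -/
def OUTc (so s₀ : Term) (bs : List Term) : Term := .lam ((Term.var 0).apps (so :: s₀ :: bs))

/-- `OUTc` head-reduces on a closed argument to the spine used by the round analysis. [folklore] -/
theorem OUTc_hbStar {so s₀ R : Term} {bs : List Term} (hso : so.Closed) (hs₀ : s₀.Closed) (hbs : ∀ b ∈ bs, b.Closed)
    (hR : R.Closed) : HBStar ((OUTc so s₀ bs).app R) (R.apps (so :: s₀ :: bs)) := by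
  have h1 := hbStar_apps_lams ((Term.var 0).apps (so :: s₀ :: bs)) 1 [R] rfl (by simp [hR]) []
  simp only [substp_apps, Term.substp, instN, List.getD, List.map_cons, hso.substp_eq, hs₀.substp_eq, apps_nil] at h1
  norm_num at h1
  rwa [show (bs.map fun N => N.substp (instN 1 [R])) = bs from
    List.map_congr_left (fun b hb => (hbs b hb).substp_eq _) |>.trans (List.map_id' bs)] at h1

/-- **The acceptance test on a row-like term**: `R so s₀ b⃗ →β* b_q` where `q` is the final
control of the finite-state fold. [cite: GaboardiMarionRonchidellarocca2008, §3.2 (Ext)] -/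
theorem outc_spec {T' : Term} {nQ nU : ℕ} {δ' : Fin nQ → Fin nU → Fin nQ} (hT : TSpec' T' nQ nU δ') (q₀ : Fin nQ)
    {R : Term} {us : List (Fin nU)} (hR : RowLike R (us.map fun u : Fin nU => oneHot nU u.val)) {bs : List Term}
    (hbs : ∀ b ∈ bs, b.Closed) (hlen : bs.length = nQ) :
    BetaReduces (R.apps (soC T' :: oneHot nQ q₀ :: bs)) (bs.getD (us.foldr (fun (u : Fin nU) (q : Fin nQ) => δ' q u) q₀).val (.var 0)) := by
  rw [show R.apps (soC T' :: oneHot nQ q₀ :: bs) = (R.apps [soC T', oneHot nQ q₀]).apps bs by rfl]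
  refine ((hR.2 _ _ (closed_soC hT.1) (closed_oneHot q₀.2)).apps_head bs).trans' ?_
  refine ((chain_soC_spec hT q₀ us).apps_head bs).trans' ?_
  exact apps_oneHot_betaReduces (us.foldr (fun (u : Fin nU) (q : Fin nQ) => δ' q u) q₀).2 hlen hbs

end STA

end Literature.Computability.ImplicitComplexity
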